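import Literature.NumberTheory.Automorphic.PairLFunctionBoundaryLandau
import Literature.NumberTheory.Automorphic.CuspidalRepChangeOfMeasure
import HarnessLib

/-!
# Arthur–Clozel (2.2) off `s = 1`: the named fact at every `(n, m, μ, μ')` from the
# Mœglin–Waldspurger continuation facts and multiplicity one (proofs only)

Topic `NumberTheory/Automorphic`; namespace `Literature.NumberTheory.Automorphic`. Proof file
(theorems only: no definition, no named fact, no instance) under the named fact
`JacquetShalika1981_partialPairL_boundary_of_ne_one` of `PairLFunctionPoles` — Arthur–Clozel,
*Simple algebras, base change, and the advanced theory of the trace formula*, Ann. of Math.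
Stud. 120 (1989), Ch. 3 §2, (2.2), p. 171 of the held copy, at the points `s₀ ≠ 1` of `Re s = 1`.

`PairLFunctionBoundaryLandau` proves the fact at ranks `(n, n)` for two cuspidal representations in
**one** space `L²_cusp(GL_n(K) A_G \ GL_n(𝔸_K), μ)` (from Mœglin–Waldspurger (i)(b), (ii) and
multiplicity one) and at ranks `n ≠ m` (from (i)(a), (ii)). The named fact, however, is quantified
over two automorphic measures `μ`, `μ'`, which at `n = m` live on the same quotient and differ by a
positive scalar (`isAutomorphicMeasure_unique_smul_holds`). This file closes that gap with the
transport of `CuspidalRepChangeOfMeasure` (a cuspidal `σ` with respect to `μ'` is, as a space of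
functions, a cuspidal `σ''` with respect to `μ` with the same Satake families,
`CuspidalAutomorphicRepGL.exists_changeMeasure_isSatakeFamilyOf`; the conclusion of (2.2) only
involves the Satake families), and assembles:

* `JacquetShalika1981_partialPairL_boundary_of_ne_one_of_same_space` — the fact at `(n, n, μ, μ')`
  from the fact at `(n, n, μ, μ)`;
* `JacquetShalika1981_partialPairL_boundary_of_ne_one_of_moeglinWaldspurger'` — the fact at
  `(n, n, μ, μ')` from Mœglin–Waldspurger (i)(b), (ii) and multiplicity one **at `μ`**;
* `JacquetShalika1981_partialPairL_boundary_of_ne_one_of_moeglinWaldspurger_all` — **the fact at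
  every `(n, m, μ, μ')` from the three Mœglin–Waldspurger named facts and `multiplicity_one_gl`**:
  the discharge `…_holds` is this theorem fed with their discharges.

## References

* J. Arthur, L. Clozel, *Simple algebras, base change, and the advanced theory of the trace
  formula*, Ann. of Math. Stud. 120 (1989), Ch. 3 §2, (2.2), p. 171. [ArthurClozelAMS120]
* C. Mœglin, J.-L. Waldspurger, *Le spectre résiduel de `GL(n)`*, Ann. Sci. ÉNS (4) 22 (1989),
  Appendice, Corollaire, p. 667. [MoeglinWaldspurger1989]
* A. Borel, H. Jacquet, *Automorphic forms and automorphic representations*, Proc. Sympos. Pure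
  Math. 33 (1979), part 1, §4.6. [BorelJacquetCorvallis1979]
-/

noncomputable section

open scoped Topology
open NumberField IsDedekindDomain MeasureTheory Filter

namespace Literature.NumberTheory.Automorphic

open AdelicGroupData

variable {n m : ℕ} {K : Type} [Field K] [NumberField K]
  {μ : Measure (gl n K).automorphicQuotient} [(gl n K).IsAutomorphicMeasure μ]
  {μ' : Measure (gl m K).automorphicQuotient} [(gl m K).IsAutomorphicMeasure μ']

/-- **Two automorphic measures at equal rank.** The named fact
`JacquetShalika1981_partialPairL_boundary_of_ne_one` at `(n, n, μ, μ')` follows from its instance at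
`(n, n, μ, μ)`: `σ` (cuspidal w.r.t. `μ' = c • μ`) has the same Satake families as its transport
`σ''` (cuspidal w.r.t. `μ`), and (2.2) only involves the Satake families.
[cite: ArthurClozelAMS120, Ch. 3 §2 (2.2)] [cite: BorelJacquetCorvallis1979, §4.6] -/
theorem JacquetShalika1981_partialPairL_boundary_of_ne_one_of_same_space
    {ν : Measure (gl n K).automorphicQuotient} [(gl n K).IsAutomorphicMeasure ν]
    (h : JacquetShalika1981_partialPairL_boundary_of_ne_one (n := n) (m := n) (K := K) (μ := μ)
      (μ' := μ)) :
    JacquetShalika1981_partialPairL_boundary_of_ne_one (n := n) (m := n) (K := K) (μ := μ)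
      (μ' := ν) := by
  intro hn hm P P' S hS α β hα hβ s₀ hs₀ hs₁
  obtain ⟨P'', hP''⟩ := CuspidalAutomorphicRepGL.exists_changeMeasure_isSatakeFamilyOf μ ν P'
  exact h hn hm P P'' hS hα (hP'' S β hβ) hs₀ hs₁

/-- **Arthur–Clozel (2.2) off `s = 1` at ranks `(n, n)`, two automorphic measures, from
Mœglin–Waldspurger**: granted Corollaire (i)(b), (ii) and multiplicity one, all **at `μ`**, the named
fact holds at `(n, n, μ, μ')` for every automorphic `μ'`
(`JacquetShalika1981_partialPairL_boundary_of_ne_one_of_moeglinWaldspurger` and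
`…_of_same_space`). [cite: ArthurClozelAMS120, Ch. 3 §2 (2.2)]
[cite: MoeglinWaldspurger1989, Appendice, Corollaire (i)(b), (ii), p. 667] -/
theorem JacquetShalika1981_partialPairL_boundary_of_ne_one_of_moeglinWaldspurger'
    {ν : Measure (gl n K).automorphicQuotient} [(gl n K).IsAutomorphicMeasure ν]
    (h₂ : MoeglinWaldspurger1989_partialPairL_entire_of_ne_conj (n := n) (K := K) (μ := μ))
    (h₃ : MoeglinWaldspurger1989_partialPairL_of_eq_conj (n := n) (K := K) (μ := μ))
    (hm1 : Literature.NumberTheory.Automorphic.multiplicity_one_gl n K μ) :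
    JacquetShalika1981_partialPairL_boundary_of_ne_one (n := n) (m := n) (K := K) (μ := μ)
      (μ' := ν) :=
  JacquetShalika1981_partialPairL_boundary_of_ne_one_of_same_space
    (JacquetShalika1981_partialPairL_boundary_of_ne_one_of_moeglinWaldspurger h₂ h₃ hm1)

/-- **Arthur–Clozel (2.2) off `s = 1` at every `(n, m, μ, μ')`, from the Mœglin–Waldspurger facts and
multiplicity one.** Granted Corollaire (i)(a) at `(n, m, μ, μ')`, Corollaire (i)(b) and multiplicity
one at `(n, μ)`, and Corollaire (ii) at `(n, μ)` and at `(m, μ')`, the named fact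
`JacquetShalika1981_partialPairL_boundary_of_ne_one` holds: for `n = m` by
`…_of_moeglinWaldspurger'` (transport between the two measures), for `n ≠ m` by
`…_of_moeglinWaldspurger_of_rank_ne`. The continuity half is the continuation; the non-vanishing
half is de la Vallée Poussin–Landau (`partialPairL_continuation_ne_zero_of_re_eq_one`) in place of
Shahidi's theorem quoted by Arthur–Clozel. The discharge `…_holds` of the fact is this theorem fed
with the discharges of the four hypotheses. [cite: ArthurClozelAMS120, Ch. 3 §2 (2.2)]
[cite: MoeglinWaldspurger1989, Appendice, Corollaire, p. 667] -/
theorem JacquetShalika1981_partialPairL_boundary_of_ne_one_of_moeglinWaldspurger_all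
    (h₁ : MoeglinWaldspurger1989_partialPairL_entire_of_rank_ne (n := n) (m := m) (K := K) (μ := μ)
      (μ' := μ'))
    (h₂ : MoeglinWaldspurger1989_partialPairL_entire_of_ne_conj (n := n) (K := K) (μ := μ))
    (h₃ : MoeglinWaldspurger1989_partialPairL_of_eq_conj (n := n) (K := K) (μ := μ))
    (h₃' : MoeglinWaldspurger1989_partialPairL_of_eq_conj (n := m) (K := K) (μ := μ'))
    (hm1 : Literature.NumberTheory.Automorphic.multiplicity_one_gl n K μ) :
    JacquetShalika1981_partialPairL_boundary_of_ne_one (n := n) (m := m) (K := K) (μ := μ)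
      (μ' := μ') := by
  by_cases hnm : n = m
  · subst hnm
    exact JacquetShalika1981_partialPairL_boundary_of_ne_one_of_moeglinWaldspurger' h₂ h₃ hm1
  · exact JacquetShalika1981_partialPairL_boundary_of_ne_one_of_moeglinWaldspurger_of_rank_ne h₁ h₃
      h₃' hnm

end Literature.NumberTheory.Automorphic

end
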